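import Summits.ResolutionOfSingularities.ResolutionOfSingularities.Theorems.HilbertSamuelEliminationSigmaMaxModificationsCorridor3WLadderIsoTailsArcLimitIdeal
import Literature.RingTheory.HilbertSamuel.Quotient
import Literature.AlgebraicGeometry.Resolution.AdicNoetherian
import Mathlib.RingTheory.MvPowerSeries.Inverse
import HarnessLib

/-!
# [OURS · L1 W4.2 · D14 ROUTE G v2 «ARC LIMIT» · G2c, file 4] (L1)–(L2): the limit ideal sits in every late strict transform

Sub-problem `ResolutionOfSingularities`, crux `SigmaMaxModifications` / conjunct `SigmaMaxModificationsCorridor3`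
(route `HilbertSamuelElimination`, line `w_ladder`), idea chain L1 C5 «K1 FREE-RATIONAL TAILS», ROUTE G v2 (memo
`L/res-L1-w42-lead-1/ROUTE-G-ARCLIMIT.md` 96c77a196e17bc23, §3 (L1)(L2)(L4)), over `…IsoTailsArcLimitIdeal`.

* §1 `hilbertFun_le_of_ker_inf_pow_le` — a general Hilbert-function comparison for two quotients `A ↠ B`, `A ↠ C` of a
  Noetherian local ring: if `ker_B ∩ 𝔪^s ⊆ (ker_C ∩ 𝔪^s) + 𝔪^{s+1}` then `H^{(0)}_C(s) ≤ H^{(0)}_B(s)` (kernel of the map on graded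
  pieces, CJS Lemma 2.24's device).
* §2 **(L1)** `exists_limitIdeal_le_sup_span_X_pow`: for a TOWER `Jn` of `t`-saturated ideals containing the scalings of `J = Jn 0`
  (the strict transforms of a free-rational tail in sheared coordinates), `∃ k₀, ∀ n ≥ k₀, J_∞ ⊆ Jn n + (t^{n−k₀})`.
* §3 **(L2) + (L4)** `hilbertFun_le_hilbertFun_limitIdeal`: if moreover all `S/Jn n` have the Hilbert function of `S/J` (NEARNESS),
  then `H^{(0)}[S/J] ≤ H^{(0)}[S/J_∞]` pointwise.

Everything is OURS; no statement of the manuscript under adjudication and no published theorem is asserted.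
[cite: CossartJannsenSaito2020, Lemma 2.24] [cite: HerrmannIkedaOrbanz1988, §30]
-/

set_option linter.dupNamespace false -- mandated namespace of this single-conjunct summit
open MvPowerSeries IsLocalRing
open Finsupp hiding some
open Literature.RingTheory.HilbertSamuel

noncomputable section

universe u v w

namespace Summit.ResolutionOfSingularities.ResolutionOfSingularities.Cruxes.SigmaMaxModifications.IdeasL1C5

namespace ArcLimit

/-! ### §1. Comparing Hilbert functions of two quotients through kernels on graded pieces -/

section Kernel

variable {A : Type u} {B : Type v} [CommRing A] [CommRing B] [IsLocalRing A] [IsLocalRing B] [IsNoetherianRing A]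
  [Algebra A B] (hf : Function.Surjective (algebraMap A B))

omit [IsNoetherianRing A] in
include hf in
/-- Pull-back of powers of the maximal ideal along a surjection of local rings: `q⁻¹(𝔪_Bⁿ) = 𝔪_Aⁿ + ker q`. [folklore] -/
theorem comap_pow_maximalIdeal_eq_sup_ker (n : ℕ) :
    (maximalIdeal B ^ n).comap (algebraMap A B) = maximalIdeal A ^ n ⊔ RingHom.ker (algebraMap A B) := by
  rw [← map_maximalIdeal_eq_of_surjective hf, ← Ideal.map_pow, Ideal.comap_map_of_surjective _ hf,
    RingHom.ker_eq_comap_bot]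

omit [IsNoetherianRing A] in
include hf in
/-- **The kernel of `𝔪_A^s/𝔪_A^{s+1} → 𝔪_B^s/𝔪_B^{s+1}`**: the classes of the elements of `𝔪_A^s ∩ (𝔪_A^{s+1} + ker)`. [folklore] -/
theorem mem_ker_gradedPieceMap_iff (s : ℕ) (x : ↥(maximalIdeal A ^ s)) :
    gradedPiece.mk _ s x ∈ LinearMap.ker (gradedPieceMap hf s) ↔
      (x : A) ∈ maximalIdeal A ^ (s + 1) ⊔ RingHom.ker (algebraMap A B) := by
  rw [LinearMap.mem_ker, gradedPieceMap_mk, gradedPiece.mk_eq_zero_iff, coe_powMaximalIdealMap_apply,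
    ← Ideal.mem_comap, comap_pow_maximalIdeal_eq_sup_ker hf]

variable {C : Type w} [CommRing C] [IsLocalRing C] [Algebra A C] (hg : Function.Surjective (algebraMap A C))

include hf hg in
/-- **Hilbert-function comparison of two quotients.** If `ker(A→B) ∩ 𝔪^s ⊆ (ker(A→C) ∩ 𝔪^s) + 𝔪^{s+1}` (the `s`-th initial forms
of `ker_B` are among those of `ker_C`), then `H^{(0)}_C(s) ≤ H^{(0)}_B(s)`. [cite: CossartJannsenSaito2020, Lemma 2.24 (device)] -/
theorem hilbertFun_le_of_ker_inf_pow_le (s : ℕ)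
    (h : RingHom.ker (algebraMap A B) ⊓ maximalIdeal A ^ s ≤
      (RingHom.ker (algebraMap A C) ⊓ maximalIdeal A ^ s) ⊔ maximalIdeal A ^ (s + 1)) :
    hilbertFun C s ≤ hilbertFun B s := by
  -- the kernels on graded pieces are nested
  have hker : LinearMap.ker (gradedPieceMap hf s) ≤ LinearMap.ker (gradedPieceMap hg s) := by
    intro q hq
    obtain ⟨x, rfl⟩ := gradedPiece.mk_surjective _ s q
    rw [mem_ker_gradedPieceMap_iff hf] at hq
    rw [mem_ker_gradedPieceMap_iff hg]
    obtain ⟨m, hm, k, hk, hmk⟩ := Submodule.mem_sup.mp hq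
    have hk' : k ∈ RingHom.ker (algebraMap A B) ⊓ maximalIdeal A ^ s := by
      refine ⟨hk, ?_⟩
      have : k = (x : A) - m := by rw [← hmk]; ring
      rw [this]
      exact Submodule.sub_mem _ x.2 (Ideal.pow_le_pow_right (Nat.le_succ s) hm)
    obtain ⟨k', hk'C, m', hm', hk'm'⟩ := Submodule.mem_sup.mp (h hk')
    rw [← hmk, ← hk'm']
    refine Submodule.add_mem _ (Submodule.mem_sup_left hm)
      (Submodule.add_mem _ (Submodule.mem_sup_right hk'C.1) (Submodule.mem_sup_left hm'))
  -- lengths: `H_A(s) = ℓ(ker_B) + H_B(s) = ℓ(ker_C) + H_C(s)` and `ℓ(ker_B) ≤ ℓ(ker_C)`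
  have hB := Module.length_eq_add_of_exact (LinearMap.ker (gradedPieceMap hf s)).subtype (gradedPieceMap hf s)
    (Submodule.subtype_injective _) (gradedPieceMap_surjective hf s) (LinearMap.exact_subtype_ker_map _)
  have hC := Module.length_eq_add_of_exact (LinearMap.ker (gradedPieceMap hg s)).subtype (gradedPieceMap hg s)
    (Submodule.subtype_injective _) (gradedPieceMap_surjective hg s) (LinearMap.exact_subtype_ker_map _)
  rw [length_gradedPiece_target_eq_hilbertFun hf, length_gradedPiece_eq_hilbertFun] at hB
  rw [length_gradedPiece_target_eq_hilbertFun hg, length_gradedPiece_eq_hilbertFun] at hC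
  have hle : Module.length A ↥(LinearMap.ker (gradedPieceMap hf s)) ≤
      Module.length A ↥(LinearMap.ker (gradedPieceMap hg s)) :=
    Module.length_le_of_injective (Submodule.inclusion hker) (Submodule.inclusion_injective hker)
  -- finite lengths
  obtain ⟨lB, hlB⟩ : ∃ l : ℕ, Module.length A ↥(LinearMap.ker (gradedPieceMap hf s)) = l := by
    induction hk : Module.length A ↥(LinearMap.ker (gradedPieceMap hf s)) using ENat.recTopCoe with
    | top => rw [hk, top_add] at hB; exact absurd hB (ENat.coe_ne_top _)
    | coe l => exact ⟨l, rfl⟩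
  obtain ⟨lC, hlC⟩ : ∃ l : ℕ, Module.length A ↥(LinearMap.ker (gradedPieceMap hg s)) = l := by
    induction hk : Module.length A ↥(LinearMap.ker (gradedPieceMap hg s)) using ENat.recTopCoe with
    | top => rw [hk, top_add] at hC; exact absurd hC (ENat.coe_ne_top _)
    | coe l => exact ⟨l, rfl⟩
  rw [hlB] at hB hle; rw [hlC] at hC hle
  have h1 : hilbertFun A s = lB + hilbertFun B s := by exact_mod_cast hB
  have h2 : hilbertFun A s = lC + hilbertFun C s := by exact_mod_cast hC
  have h3 : lB ≤ lC := by exact_mod_cast hle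
  omega

include hf hg in
/-- Equality version: same `s`-th initial forms ⇒ same `H^{(0)}(s)`. [cite: CossartJannsenSaito2020, Lemma 2.24 (device)] -/
theorem hilbertFun_eq_of_ker_inf_pow_sup_eq (s : ℕ)
    (h : (RingHom.ker (algebraMap A B) ⊓ maximalIdeal A ^ s) ⊔ maximalIdeal A ^ (s + 1) =
      (RingHom.ker (algebraMap A C) ⊓ maximalIdeal A ^ s) ⊔ maximalIdeal A ^ (s + 1)) :
    hilbertFun B s = hilbertFun C s :=
  le_antisymm (hilbertFun_le_of_ker_inf_pow_le hg hf s (le_sup_left.trans h.ge))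
    (hilbertFun_le_of_ker_inf_pow_le hf hg s (le_sup_left.trans h.le))

end Kernel

/-! ### §2. (L1): the limit ideal sits in every late strict transform -/

section Tower

variable {d : ℕ} {K : Type u} [CommRing K]

/-- The hypotheses on the TOWER of formal strict transforms `Jn` of `J = Jn 0` in sheared coordinates: each `Jn n` is `t`-saturated
and contains the `n`-th scaling of `J`. (A structure-free conjunction, used as two named hypotheses below.) [folklore] -/
theorem mem_of_X_pow_mul_mem {Jn : ℕ → Ideal (MvPowerSeries (Fin (d + 1)) K)}
    (hsat : ∀ n f, X 0 * f ∈ Jn n → f ∈ Jn n) (n k : ℕ) {f : MvPowerSeries (Fin (d + 1)) K}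
    (h : X 0 ^ k * f ∈ Jn n) : f ∈ Jn n := by
  induction k with
  | zero => simpa using h
  | succ k ih => exact ih (hsat n _ (by rw [← mul_assoc, ← pow_succ']; exact h))

/-- One generator: `φ ∈ satLayer J j` lies in `Jn n + (t^{n−k})` for its saturation exponent `k ≤ n`. [folklore] -/
theorem mem_sup_span_of_mem_satLayer {J : Ideal (MvPowerSeries (Fin (d + 1)) K)} {Jn : ℕ → Ideal (MvPowerSeries (Fin (d + 1)) K)}
    (hsat : ∀ n f, X 0 * f ∈ Jn n → f ∈ Jn n) (hscale : ∀ n g, g ∈ J → subst (scale d K n) g ∈ Jn n)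
    {j k : ℕ} {φ : MvPowerSeries (Fin (d + 1)) K}
    (hk : X 0 ^ k * φ ∈ layerSub J j) {n : ℕ} (hn : k ≤ n) :
    φ ∈ Jn n ⊔ Ideal.span {X 0 ^ (n - k)} := by
  obtain ⟨g, hgJ, hgP, hg⟩ := mem_layerSub_iff.mp hk
  obtain ⟨ρ, hρ⟩ := exists_subst_scale_eq_of_mem_pow n hgP
  -- `scale_n g = t^{nj} (t^k φ + tⁿ ρ) = t^{nj+k} (φ + t^{n-k} ρ)`
  have hmem : X 0 ^ (n * j + k) * (φ + X 0 ^ (n - k) * ρ) ∈ Jn n := by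
    have := hscale n g hgJ
    rw [hρ, hg] at this
    have e : X 0 ^ (n * j) * (X 0 ^ k * φ + X 0 ^ n * ρ) =
        X 0 ^ (n * j + k) * (φ + X 0 ^ (n - k) * ρ) := by
      rw [show (X 0 : MvPowerSeries (Fin (d + 1)) K) ^ n = X 0 ^ k * X 0 ^ (n - k) by
        rw [← pow_add, Nat.add_sub_cancel' hn]]
      ring
    rwa [e] at this
  have hφρ := mem_of_X_pow_mul_mem hsat n (n * j + k) hmem
  have : φ = (φ + X 0 ^ (n - k) * ρ) - ρ * X 0 ^ (n - k) := by ring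
  rw [this]
  exact Submodule.sub_mem _ (Submodule.mem_sup_left hφρ)
    (Submodule.mem_sup_right (Ideal.mul_mem_left _ _ (Ideal.mem_span_singleton_self _)))

/-- **(L1)** For the tower of `t`-saturated ideals `Jn ⊇ scale_n(J)`: there is `k₀` with `J_∞ ⊆ Jn n + (t^{n−k₀})` for all `n ≥ k₀`.
[folklore] -/
theorem exists_limitIdeal_le_sup_span_X_pow [IsNoetherianRing (MvPowerSeries (Fin (d + 1)) K)]
    (J : Ideal (MvPowerSeries (Fin (d + 1)) K)) {Jn : ℕ → Ideal (MvPowerSeries (Fin (d + 1)) K)}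
    (hsat : ∀ n f, X 0 * f ∈ Jn n → f ∈ Jn n) (hscale : ∀ n g, g ∈ J → subst (scale d K n) g ∈ Jn n) :
    ∃ k₀ : ℕ, ∀ n, k₀ ≤ n → limitIdeal J ≤ Jn n ⊔ Ideal.span {X 0 ^ (n - k₀)} := by
  classical
  -- a finite generating set of `J_∞` inside `⋃ satLayer`
  have hfg : (limitIdeal J).FG := (isNoetherian_def.mp inferInstance) _
  obtain ⟨T, hTsub, hTspan⟩ := (Submodule.fg_span_iff_fg_span_finset_subset _).mp hfg
  -- saturation exponents of the generators
  have hgen : ∀ φ ∈ T, ∃ jk : ℕ × ℕ, IsWeightedHomogeneous (yW d) φ jk.1 ∧ X 0 ^ jk.2 * φ ∈ layerSub J jk.1 := by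
    intro φ hφ
    obtain ⟨j, hj, k, hk⟩ := Set.mem_iUnion.mp (hTsub hφ)
    exact ⟨(j, k), hj, hk⟩
  choose! jk hjk using hgen
  refine ⟨T.sup fun φ => (jk φ).2, fun n hn => ?_⟩
  have hspan : limitIdeal J = Ideal.span (T : Set (MvPowerSeries (Fin (d + 1)) K)) := hTspan
  rw [hspan]
  refine Ideal.span_le.mpr fun φ hφ => ?_
  have hkφ : (jk φ).2 ≤ T.sup fun φ => (jk φ).2 := Finset.le_sup (f := fun φ => (jk φ).2) hφ
  have h := mem_sup_span_of_mem_satLayer hsat hscale (hjk φ hφ).2 (n := n) (hkφ.trans hn)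
  have hsub : Ideal.span {(X 0 : MvPowerSeries (Fin (d + 1)) K) ^ (n - (jk φ).2)} ≤
      Ideal.span {X 0 ^ (n - T.sup fun φ => (jk φ).2)} := by
    rw [Ideal.span_singleton_le_span_singleton]
    exact pow_dvd_pow _ (by omega)
  exact (sup_le_sup_left hsub _) h

/-! ### §3. (L2) + (L4): the Hilbert function of `S/J` is bounded by that of `S/J_∞` -/

/-- `t = X 0` lies in the maximal ideal of `K⟦t, y⟧`. [folklore] -/
theorem X_zero_mem_maximalIdeal [IsLocalRing K] :
    (X 0 : MvPowerSeries (Fin (d + 1)) K) ∈ maximalIdeal (MvPowerSeries (Fin (d + 1)) K) := by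
  rw [IsLocalRing.mem_maximalIdeal, mem_nonunits_iff, MvPowerSeries.isUnit_iff_constantCoeff, constantCoeff_X]
  exact not_isUnit_zero

/-- **(L2)**: for `n > s + k₀`, `J_∞ ∩ 𝔪^s ⊆ (Jn n ∩ 𝔪^s) + 𝔪^{s+1}`. [folklore] -/
theorem limitIdeal_inf_pow_le [IsLocalRing K] {J : Ideal (MvPowerSeries (Fin (d + 1)) K)}
    {Jn : ℕ → Ideal (MvPowerSeries (Fin (d + 1)) K)} {k₀ n s : ℕ}
    (hle : limitIdeal J ≤ Jn n ⊔ Ideal.span {X 0 ^ (n - k₀)}) (hn : s + 1 + k₀ ≤ n) :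
    limitIdeal J ⊓ maximalIdeal (MvPowerSeries (Fin (d + 1)) K) ^ s ≤
      (Jn n ⊓ maximalIdeal (MvPowerSeries (Fin (d + 1)) K) ^ s) ⊔ maximalIdeal (MvPowerSeries (Fin (d + 1)) K) ^ (s + 1) := by
  rintro F ⟨hF, hFs⟩
  obtain ⟨f, hf, c, hc, hfc⟩ := Submodule.mem_sup.mp (hle hF)
  obtain ⟨a, rfl⟩ := Ideal.mem_span_singleton'.mp hc
  have hc' : a * X 0 ^ (n - k₀) ∈ maximalIdeal (MvPowerSeries (Fin (d + 1)) K) ^ (s + 1) :=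
    Ideal.pow_le_pow_right (by omega) (Ideal.mul_mem_left _ a (Ideal.pow_mem_pow X_zero_mem_maximalIdeal _))
  have hf' : f ∈ maximalIdeal (MvPowerSeries (Fin (d + 1)) K) ^ s := by
    have : f = F - a * X 0 ^ (n - k₀) := by rw [← hfc]; ring
    rw [this]
    exact Submodule.sub_mem _ hFs (Ideal.pow_le_pow_right (Nat.le_succ s) hc')
  rw [← hfc]
  exact Submodule.add_mem _ (Submodule.mem_sup_left ⟨hf, hf'⟩) (Submodule.mem_sup_right hc')

/-- **(L2) + (L4): `H^{(0)}[S/J] ≤ H^{(0)}[S/J_∞]`** for the tower of `t`-saturated strict transforms with constant Hilbert function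
(nearness). [folklore] -/
theorem hilbertFun_le_hilbertFun_limitIdeal {K : Type u} [Field K]
    {Jn : ℕ → Ideal (MvPowerSeries (Fin (d + 1)) K)}
    (hsat : ∀ n f, X 0 * f ∈ Jn n → f ∈ Jn n) (hscale : ∀ n g, g ∈ Jn 0 → subst (scale d K n) g ∈ Jn n)
    [hloc : ∀ n, IsLocalRing (MvPowerSeries (Fin (d + 1)) K ⧸ Jn n)]
    [IsLocalRing (MvPowerSeries (Fin (d + 1)) K ⧸ limitIdeal (Jn 0))]
    (hHS : ∀ n, hilbertFun (MvPowerSeries (Fin (d + 1)) K ⧸ Jn n) = hilbertFun (MvPowerSeries (Fin (d + 1)) K ⧸ Jn 0)) (s : ℕ) :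
    hilbertFun (MvPowerSeries (Fin (d + 1)) K ⧸ Jn 0) s ≤ hilbertFun (MvPowerSeries (Fin (d + 1)) K ⧸ limitIdeal (Jn 0)) s := by
  haveI : IsNoetherianRing (MvPowerSeries (Fin (d + 1)) K) :=
    Literature.AlgebraicGeometry.Resolution.isNoetherianRing_mvPowerSeries K (Fin (d + 1))
  obtain ⟨k₀, hk₀⟩ := exists_limitIdeal_le_sup_span_X_pow (Jn 0) hsat hscale
  have hL2 := limitIdeal_inf_pow_le (s := s) (hk₀ (s + 1 + k₀) (by omega)) (le_refl _)
  rw [← hHS (s + 1 + k₀)]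
  refine hilbertFun_le_of_ker_inf_pow_le (A := MvPowerSeries (Fin (d + 1)) K)
    (B := MvPowerSeries (Fin (d + 1)) K ⧸ limitIdeal (Jn 0)) (C := MvPowerSeries (Fin (d + 1)) K ⧸ Jn (s + 1 + k₀))
    Ideal.Quotient.mk_surjective Ideal.Quotient.mk_surjective s ?_
  rw [Ideal.Quotient.algebraMap_eq, Ideal.mk_ker, Ideal.Quotient.algebraMap_eq, Ideal.mk_ker]
  exact hL2

end Tower

end ArcLimit

end Summit.ResolutionOfSingularities.ResolutionOfSingularities.Cruxes.SigmaMaxModifications.IdeasL1C5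

end
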